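import Literature.Computability.QuantumComplexity.SimUniformity
import Literature.Computability.Complexity.CountingHierarchyProofs
import Literature.Computability.Complexity.UniformProbBlocks
import Literature.Computability.Complexity.SumcheckMAGame
import Literature.Computability.Complexity.BitCodecs
import HarnessLib

/-!
# Value-determined lifts, core: exact `#P` acceptance probabilities, counting, bisection

Solo programme `solo-QuantumAdvantage-informed`, theorem N1 ("a lift of the door's threshold problem
that is a function of the acceptance probability decides unique-circuit-SAT"), part 1 of 3 (model-free
core). The door of this programme (`SoloInformedCanonicalBit.promiseIsLift_iff_thresholdLift`) reduces
`Q-EXT : PromiseBQP ⊆ promiseLift BQP` to: for every uniform oracle-free Clifford+`T` family `F` some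
`BQP` language `L` solves the threshold problem `⟨{x | 7/12 ≤ p_F x}, {x | p_F x ≤ 5/12}⟩`. The cheapest
imaginable such `L` would be a *rounding rule*: membership a function of the value `p_F x` alone. Parts
2–3 show that for an explicit classical-coin family this forces `L` to decide unique-circuit-SAT with
`|x|` adaptive queries. This file supplies the three model-free ingredients:

* `exists_family_acceptProbOn_eq_uniformProb` — **every `P`-predicate's coin-counting probability is
  the exact acceptance probability of a uniform oracle-free Clifford+`T` family**: for `R ∈ P` and a
  polynomial `p` there is `F` with `p_F x = Pr_{y ∈ {0,1}^{p|x|}}[⟨x, y⟩ ∈ R]` (the coin family of the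
  tree's `BPP ⊆ BQP` proof, `coinFamily_acceptProbOn` + `uniformReversibleSimulation_holds`);
* counting: `uniformProb_succ_split` (condition on the first coin), `card_filter_bitsToNat_lt`
  (`#{W ∈ {0,1}^n | val W < c} = min c 2^n`), `uniformProb_bitsToNat_ge` (events agreeing on length-`m` strings:
  `SumcheckMA.uniformProb_congr_len` of `SumcheckMAGame.lean`);
* `bisect_adjacent` — the **discrete intermediate-value bisection**: if position `0` is good, position
  `2^{v+1}` is bad, and each of the `v + 1` midpoint questions is answered truthfully ("good" recorded as
  `1`), the search ends at a good `C` with `C + 1` bad — NO monotonicity is assumed (between the two ends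
  the answers may be arbitrary) — together with the little-endian numeral bookkeeping of the answer
  string (`lo`, `midCode`, `bitsToNat_midCode`, `lo_append`).

References: Bernstein–Vazirani 1997, Thm. 8.3 (proof: coin superposition + reversible simulation);
Arora–Barak 2009, §7.1 (coin counting), §17.2.1 and Lemma 17.7 (binary search with an oracle).
-/

namespace Summit.QuantumAdvantage.QuantumAdvantage.Theorems

open _root_.Computability Literature.Computability.Complexity Literature.Computability.Complexity.Classes
  Literature.Computability.Cryptography Literature.Computability.QuantumComplexity

/-! ### Every `P`-predicate's coin probability is an exact quantum acceptance probability -/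

/-- **Exact `#P` acceptance probabilities.** For `R ∈ P` and a polynomial `p` there is a uniform
oracle-free Clifford+`T` family whose acceptance probability on `x` is EXACTLY
`Pr_{y ∈ {0,1}^{p(|x|)}}[⟨x, y⟩ ∈ R] = #{y | ⟨x,y⟩ ∈ R} / 2^{p|x|}` (Hadamards on the coin wires, then the
reversible simulation of the `P`-machine for `R`; the quantum half of Bernstein–Vazirani's `BPP ⊆ BQP`).
[cite: BernsteinVazirani1997, Thm. 8.3 (proof)] [cite: AroraBarak2009, Cor. 10.11] -/
theorem exists_family_acceptProbOn_eq_uniformProb {R : Language Bool} (hR : R ∈ P) (p : Polynomial ℕ) :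
    ∃ F : QCircuitFamily cliffordT, F.IsOracleFree ∧ F.IsUniform ∧
      ∀ x, F.acceptProbOn 0 x = uniformProb (p.eval x.length) {y | boolPair x y ∈ R} := by
  classical
  obtain ⟨m, D, out, hfree, hunif, hD, hinj, hout⟩ := uniformReversibleSimulation_holds R hR p
  refine ⟨coinFamily (fun n => p.eval n) m D, coinFamily_isOracleFree hfree, hunif, fun x => ?_⟩
  rw [coinFamily_acceptProbOn hD hinj, uniformProb_eq_card_ofFn]
  congr 2
  refine congrArg Finset.card (Finset.filter_congr fun y _ => ?_)
  rw [hout, List.ofFn_get, Set.mem_setOf_eq]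

/-! ### Counting lemmas -/

/-- **Conditioning on the first coin**: `Pr_{y ∈ {0,1}^{m+1}}[E] = (Pr_{r}[1r ∈ E] + Pr_{r}[0r ∈ E]) / 2`.
[cite: AroraBarak2009, §7.1] -/
theorem uniformProb_succ_split (m : ℕ) (E : Set (List Bool)) :
    uniformProb (m + 1) E =
      (uniformProb m {r | true :: r ∈ E} + uniformProb m {r | false :: r ∈ E}) / 2 := by
  classical
  rw [uniformProb_eq_card_fun, uniformProb_eq_card_fun, uniformProb_eq_card_fun]
  have key : (Finset.univ.filter fun f : Fin (m + 1) → Bool => List.ofFn f ∈ E).card =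
      (Finset.univ.filter fun f : Fin m → Bool => List.ofFn f ∈ {r | true :: r ∈ E}).card +
        (Finset.univ.filter fun f : Fin m → Bool => List.ofFn f ∈ {r | false :: r ∈ E}).card := by
    rw [← Finset.card_equiv (Fin.consEquiv fun _ => Bool)
      (s := Finset.univ.filter fun q : Bool × (Fin m → Bool) => q.1 :: List.ofFn q.2 ∈ E)
      (t := Finset.univ.filter fun f : Fin (m + 1) → Bool => List.ofFn f ∈ E)
      (fun q => by simp [Fin.consEquiv, List.ofFn_succ])]
    simp only [Finset.card_filter, Fintype.sum_prod_type, Fintype.sum_bool, Set.mem_setOf_eq]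
  rw [key]
  push_cast
  have e : ∀ a b : ℝ, (a + b) / 2 ^ (m + 1) = (a / 2 ^ m + b / 2 ^ m) / 2 := fun a b => by
    rw [pow_succ]; field_simp
  exact e _ _

/-- `bitsToNat` is injective on vectors of a fixed length. [folklore] -/
theorem bitsToNat_toList_injective (n : ℕ) :
    Function.Injective fun W : List.Vector Bool n => bitsToNat W.toList := by
  intro W W' h
  apply List.Vector.toList_injective
  have h1 := CoinEnum.natBits_bitsToNat W.toList
  have h2 := CoinEnum.natBits_bitsToNat W'.toList
  rw [W.toList_length] at h1
  rw [W'.toList_length] at h2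
  rw [← h1, ← h2]
  exact congrArg _ h

/-- The numerals of the `n`-bit strings are exactly `0, …, 2^n - 1`. [folklore] -/
theorem image_bitsToNat_univ (n : ℕ) :
    open scoped Classical in
    (Finset.univ.image fun W : List.Vector Bool n => bitsToNat W.toList) = Finset.range (2 ^ n) := by
  classical
  apply Finset.eq_of_subset_of_card_le
  · intro k hk
    obtain ⟨W, -, rfl⟩ := Finset.mem_image.1 hk
    rw [Finset.mem_range]
    simpa [W.toList_length] using bitsToNat_lt W.toList
  · rw [Finset.card_range, Finset.card_image_of_injective _ (bitsToNat_toList_injective n),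
      Finset.card_univ, card_vector, Fintype.card_bool]

/-- **Counting numerals below a threshold**: among the `n`-bit little-endian numerals exactly
`min c 2^n` have value `< c`. [folklore] -/
theorem card_filter_bitsToNat_lt (n c : ℕ) :
    open scoped Classical in
    (Finset.univ.filter fun W : List.Vector Bool n => bitsToNat W.toList < c).card = min c (2 ^ n) := by
  classical
  rw [← Finset.card_image_of_injective _ (bitsToNat_toList_injective n),
    ← Finset.filter_image (f := fun W : List.Vector Bool n => bitsToNat W.toList) (p := fun k => k < c),
    image_bitsToNat_univ]
  have : (Finset.range (2 ^ n)).filter (fun k => k < c) = Finset.range (min c (2 ^ n)) := by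
    ext k
    simp only [Finset.mem_filter, Finset.mem_range]
    omega
  rw [this, Finset.card_range]

/-- **Probability of a numeral at least `c`**: `Pr_{W ∈ {0,1}^n}[¬ val W < c] = (2^n - min c 2^n) / 2^n`.
[folklore] -/
theorem uniformProb_bitsToNat_ge (n c : ℕ) :
    uniformProb n {W | ¬ bitsToNat W < c} = ((2 ^ n - min c (2 ^ n) : ℕ) : ℝ) / 2 ^ n := by
  classical
  unfold uniformProb
  congr 2
  have h := Finset.card_filter_add_card_filter_not
    (s := (Finset.univ : Finset (List.Vector Bool n))) (fun W => bitsToNat W.toList < c)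
  rw [card_filter_bitsToNat_lt, Finset.card_univ, card_vector, Fintype.card_bool] at h
  have h' : (Finset.univ.filter fun W : List.Vector Bool n => ¬ bitsToNat W.toList < c).card =
      2 ^ n - min c (2 ^ n) := by omega
  simp only [Set.mem_setOf_eq]
  exact_mod_cast h'

/-! ### Bisection bookkeeping: the answer string as a numeral -/

/-- The lower end of the search interval after the answers `a` (oldest first, `1` = "the midpoint was
good"): `lo v a = ∑_{j<|a|} a_j 2^{v-j} = 2^{v+1-|a|} · val(aᴿ)`. [cite: AroraBarak2009, Lemma 17.7 (proof)] -/
def lo (v : ℕ) (a : List Bool) : ℕ := 2 ^ (v + 1 - a.length) * bitsToNat a.reverse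

/-- The little-endian code of the midpoint `lo + 2^{v-|a|}` asked after the answers `a`:
`0^{v-|a|} 1 aᴿ` (length `v + 1`). [cite: AroraBarak2009, Lemma 17.7 (proof)] -/
def midCode (v : ℕ) (a : List Bool) : List Bool := List.replicate (v - a.length) false ++ true :: a.reverse

/-- `lo v [] = 0`. [folklore] -/
@[simp] theorem lo_nil (v : ℕ) : lo v [] = 0 := by simp [lo]

/-- Length of the midpoint code. [folklore] -/
theorem length_midCode {v : ℕ} {a : List Bool} (h : a.length ≤ v) : (midCode v a).length = v + 1 := by
  simp [midCode]; omega

/-- **The midpoint code denotes the midpoint**: `val (midCode v a) = lo v a + 2^{v-|a|}` (`|a| ≤ v`).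
[cite: AroraBarak2009, Lemma 17.7 (proof)] -/
theorem bitsToNat_midCode {v : ℕ} {a : List Bool} (h : a.length ≤ v) :
    bitsToNat (midCode v a) = lo v a + 2 ^ (v - a.length) := by
  rw [midCode, bitsToNat_append, bitsToNat_replicate_false, List.length_replicate, bitsToNat_cons, lo,
    show v + 1 - a.length = v - a.length + 1 from by omega, pow_succ]
  simp [Bool.toNat]
  ring

/-- **One more answer moves the lower end by `b · 2^{v-|a|}`.** [cite: AroraBarak2009, Lemma 17.7 (proof)] -/
theorem lo_append {v : ℕ} {a : List Bool} (h : a.length ≤ v) (b : Bool) :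
    lo v (a ++ [b]) = lo v a + b.toNat * 2 ^ (v - a.length) := by
  rw [lo, lo, List.reverse_append, List.reverse_singleton, List.singleton_append, bitsToNat_cons,
    List.length_append, List.length_singleton,
    show v + 1 - a.length = v - a.length + 1 from by omega,
    show v + 1 - (a.length + 1) = v - a.length from by omega, pow_succ]
  ring

/-- After `v + 1` answers the lower end is the numeral of the reversed answer string. [folklore] -/
theorem lo_eq_of_length {v : ℕ} {a : List Bool} (h : a.length = v + 1) : lo v a = bitsToNat a.reverse := by
  simp [lo, h]

/-- The lower end stays below `2^{v+1} - 2^{v+1-|a|}` … stated as the bound actually used: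
`lo v a + 2^{v+1-|a|} ≤ 2^{v+1}` for `|a| ≤ v + 1`. [folklore] -/
theorem lo_add_pow_le {v : ℕ} {a : List Bool} (h : a.length ≤ v + 1) :
    lo v a + 2 ^ (v + 1 - a.length) ≤ 2 ^ (v + 1) := by
  have hlt := bitsToNat_lt a.reverse
  rw [List.length_reverse] at hlt
  rw [lo]
  have : 2 ^ (v + 1) = 2 ^ (v + 1 - a.length) * 2 ^ a.length := by
    rw [← pow_add]; congr 1; omega
  rw [this]
  nlinarith [Nat.one_le_two_pow (n := v + 1 - a.length)]

/-! ### The discrete intermediate-value bisection -/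

/-- **Bisection finds an adjacent good/bad pair, with no monotonicity.** Let `a k` be the answer
strings of a run (`a 0 = []`, `a (k+1) = a k ++ [β k]`), where the `k`-th question (for `k ≤ v`) asks
about the midpoint `lo v (a k) + 2^{v-k}` and is answered truthfully: `β k = 1` only if the midpoint is
`Good`, `β k = 0` only if it is `Bad`. If `0` is good and `2^{v+1}` is bad then after every `k ≤ v + 1`
rounds `lo v (a k)` is good and `lo v (a k) + 2^{v+1-k}` is bad; in particular after `v + 1` rounds
`C = val((a (v+1))ᴿ)` is good and `C + 1` is bad. [cite: AroraBarak2009, §17.2.1 (binary search), Lemma 17.7 (proof)] -/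
theorem bisect_invariant {Good Bad : ℕ → Prop} {v : ℕ} {a : ℕ → List Bool} {β : ℕ → Bool}
    (h0 : a 0 = []) (hstep : ∀ k, a (k + 1) = a k ++ [β k])
    (hG : Good 0) (hB : Bad (2 ^ (v + 1)))
    (htrue : ∀ k ≤ v, β k = true → Good (lo v (a k) + 2 ^ (v - k)))
    (hfalse : ∀ k ≤ v, β k = false → Bad (lo v (a k) + 2 ^ (v - k))) :
    ∀ k ≤ v + 1, Good (lo v (a k)) ∧ Bad (lo v (a k) + 2 ^ (v + 1 - k)) := by
  have hlen : ∀ k, (a k).length = k := by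
    intro k
    induction k with
    | zero => simp [h0]
    | succ k ih => simp [hstep, ih]
  intro k
  induction k with
  | zero => intro _; simpa [h0] using And.intro hG hB
  | succ k ih =>
    intro hk
    obtain ⟨ihG, ihB⟩ := ih (by omega)
    have hkv : k ≤ v := by omega
    have hla : (a k).length ≤ v := by rw [hlen]; exact hkv
    rw [hstep, lo_append hla, hlen]
    have hpow : 2 ^ (v + 1 - k) = 2 ^ (v - k) + 2 ^ (v - k) := by
      rw [show v + 1 - k = v - k + 1 from by omega, pow_succ]; ring
    cases hb : β k
    · refine ⟨by simpa using ihG, ?_⟩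
      simpa [show v + 1 - (k + 1) = v - k from by omega] using hfalse k hkv hb
    · refine ⟨by simpa using htrue k hkv hb, ?_⟩
      rw [show v + 1 - (k + 1) = v - k from by omega, Bool.toNat_true, one_mul, add_assoc, ← hpow]
      exact ihB

/-- **End of the bisection**: with the hypotheses of `bisect_invariant`, `C := val((a (v+1))ᴿ)` is good
and `C + 1` is bad (and `C + 1 ≤ 2^{v+1}`). [cite: AroraBarak2009, §17.2.1, Lemma 17.7 (proof)] -/
theorem bisect_adjacent {Good Bad : ℕ → Prop} {v : ℕ} {a : ℕ → List Bool} {β : ℕ → Bool}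
    (h0 : a 0 = []) (hstep : ∀ k, a (k + 1) = a k ++ [β k])
    (hG : Good 0) (hB : Bad (2 ^ (v + 1)))
    (htrue : ∀ k ≤ v, β k = true → Good (lo v (a k) + 2 ^ (v - k)))
    (hfalse : ∀ k ≤ v, β k = false → Bad (lo v (a k) + 2 ^ (v - k))) :
    Good (bitsToNat (a (v + 1)).reverse) ∧ Bad (bitsToNat (a (v + 1)).reverse + 1) ∧
      bitsToNat (a (v + 1)).reverse + 1 ≤ 2 ^ (v + 1) := by
  have hlen : ∀ k, (a k).length = k := by
    intro k
    induction k with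
    | zero => simp [h0]
    | succ k ih => simp [hstep, ih]
  have h := bisect_invariant h0 hstep hG hB htrue hfalse (v + 1) le_rfl
  rw [lo_eq_of_length (hlen _), Nat.sub_self, pow_zero] at h
  refine ⟨h.1, h.2, ?_⟩
  have hb := lo_add_pow_le (v := v) (a := a (v + 1)) (by rw [hlen])
  rwa [lo_eq_of_length (hlen _), hlen, Nat.sub_self, pow_zero] at hb

end Summit.QuantumAdvantage.QuantumAdvantage.Theorems
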